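import Literature.MathematicalPhysics.QuantumLattice.CentreSymmetry
import HarnessLib

/-!
# Cubes in a slab: the combinatorics of Chatterjee's averaged cube dynamics
# (Chatterjee, CMP 385 (2021), §§9–11; Dobrushin–Shlosman's condition `C_V` for cube windows)

S. Chatterjee, *A probabilistic mechanism for quark confinement*, CMP **385** (2021) [Chatterjee2021], §§9–11,
couples two Gibbs measures of the slab `{0,…,n} × ℤ^{d−1}` by resampling, at each step, a UNIFORMLY RANDOM cube of
full temporal height lying in the slab (the «global update map» `τ = |𝔅|^{-1} Σ_B τ_B`, §10); the proof of
Lemma 11.1 rests on two counts: an interior link lies in `≍ N^{d−1}` cubes (§11: «`|𝔅(e)| > C N^{d−1}`»), and a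
link lies on the SPATIAL boundary of at most `C N^{d−2}` of them (proof of Lemma 10.1), the temporal faces carrying
no disagreement because the two boundary conditions agree there. The tree runs Chatterjee's scheme through the
Dobrushin–Shlosman window comparison in the averaged form (`DobrushinShlosmanUniquenessBulk.lean`); this file
supplies its purely combinatorial inputs for the system of CUBE WINDOWS of the slab:

* windows: to every interior slab link `c` the interior link set of the cube `b(c) + {0,…,n}^d`,
  `b(c) = (0, c₁ − 1, …, c_{d−1} − 1)` (so `c` lies in its own window, `self_mem_cubeInterior_base`; interior cube
  links are interior slab links, `isSlabInteriorEdge_of_mem_cubeInterior`);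
* a boundary link of such a cube that is an interior SLAB link lies on a SPATIAL face
  (`exists_spatial_face_of_boundary`) — Chatterjee's «`δ` and `δ'` agree on the temporal faces»;
* shell counting `card_filter_floor_norm_sub_eq_le` / `sum_floor_norm_le_sum_range`: at most `d (2k+1)^d` links at
  base-point sup-distance `k`, so `Σ_y κ(⌊‖x−y‖⌋) ≤ Σ_{k ≤ n} d(2k+1)^d κ(k)` over links within `n` of `x`;
* pinned-coordinate counting `card_filter_apply_eq_le`, `card_cover_boundary_le`: a link `y` lies on a spatial face
  of at most `2d(d−1)(n+1)^{d−1}` of the candidate cubes around `x`;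
* ★ `sum_cover_boundary_influence_le` — the AVERAGED received sum of Dobrushin–Shlosman's `C_V` for this window
  system: `Σ_{c : x ∈ win c} Σ_{y ∈ ∂_spatial win c} κ(⌊‖x−y‖⌋) ≤ 2d(d−1)(n+1)^{d−1} Σ_{k ≤ n} d(2k+1)^d κ(k)`;
* `le_card_cover`: an interior slab link lies in at least `(n−1)^d` windows; `mem_cover_iff`;
* `exists_exhaustion_profile`: the finite volumes `{interior slab links with spatial coordinates in [−L, L]}`
  with the profile `⌊(L − ‖x‖_{∞,spatial})/(n+2)⌋`, adapted to the cube windows (the exhaustion hypothesis of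
  `DobrushinShlosman.measure_eq_of_frozen_dlr_window_bulk`).

Pure lattice combinatorics: no measure, no gauge group. The link sets are passed as explicit `Finset` formulas
(the tree's convention of `StrongExpDecayLGT.lean`), no definitions.

## References
* S. Chatterjee, CMP 385 (2021), arXiv:2006.16229: §9 (cubes `𝔅` in the slab, `U(e)`, `V(e)`), proof of
  Lemma 10.1 («at most `C N^{d−2}` cubes `B` such that `e ∈ ∂'E`»), proof of Lemma 11.1 («`|𝔅(e)| > C N^{d−1}`»).
* R. L. Dobrushin, S. B. Shlosman (1985), Thm. 1 (condition `C_V`).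
-/

noncomputable section

open Finset Function

namespace Literature.MathematicalPhysics.QuantumLattice

section SlabCubes

variable {d : ℕ}

/-! ### §1 Cubes, their interior links and their faces -/

/-- Membership in the interior link set of the cube `v + {0,…,n}^d`, unfolded. [folklore] -/
private theorem mem_cubeInterior_iff {v : Fin d → ℤ} {n : ℕ} {Λ : Finset (ZdEdge d)}
    (hΛ : Λ = (((Fintype.piFinset fun j : Fin d => Finset.Icc (v j) (v j + n)) ×ˢ
        (Finset.univ : Finset (Fin d))).filter fun e =>
          e.1 e.2 + 1 ≤ v e.2 + n ∧ ∀ j, j ≠ e.2 → v j < e.1 j ∧ e.1 j < v j + n))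
    (u : ZdEdge d) :
    u ∈ Λ ↔ (∀ j, v j ≤ u.1 j ∧ u.1 j ≤ v j + n) ∧ u.1 u.2 + 1 ≤ v u.2 + n ∧
      ∀ j, j ≠ u.2 → v j < u.1 j ∧ u.1 j < v j + n := by
  classical
  rw [hΛ]
  simp only [Finset.mem_filter, Finset.mem_product, Fintype.mem_piFinset, Finset.mem_Icc,
    Finset.mem_univ, and_true]

/-- Membership in the link set of the cube `v + {0,…,n}^d`, unfolded. [folklore] -/
private theorem mem_cubeEdges_iff {v : Fin d → ℤ} {n : ℕ} {E : Finset (ZdEdge d)}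
    (hE : E = (((Fintype.piFinset fun j : Fin d => Finset.Icc (v j) (v j + n)) ×ˢ
        (Finset.univ : Finset (Fin d))).filter fun e => e.1 e.2 + 1 ≤ v e.2 + n))
    (u : ZdEdge d) :
    u ∈ E ↔ (∀ j, v j ≤ u.1 j ∧ u.1 j ≤ v j + n) ∧ u.1 u.2 + 1 ≤ v u.2 + n := by
  classical
  rw [hE]
  simp only [Finset.mem_filter, Finset.mem_product, Fintype.mem_piFinset, Finset.mem_Icc,
    Finset.mem_univ, and_true]

/-- **Interior cube links are interior slab links**: the interior links of a cube `v + {0,…,n}^d` with `v₀ = 0`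
(full temporal height of the slab `{0 ≤ x₀ ≤ n}`) are interior links of the slab (Chatterjee 2021 §9: the cubes
`B ∈ 𝔅` lie in `S_{M,N}`). [cite: Chatterjee2021, §9] -/
theorem isSlabInteriorEdge_of_mem_cubeInterior [NeZero d] {v : Fin d → ℤ} {n : ℕ} (hv0 : v 0 = 0)
    {Λ : Finset (ZdEdge d)}
    (hΛ : Λ = (((Fintype.piFinset fun j : Fin d => Finset.Icc (v j) (v j + n)) ×ˢ
        (Finset.univ : Finset (Fin d))).filter fun e =>
          e.1 e.2 + 1 ≤ v e.2 + n ∧ ∀ j, j ≠ e.2 → v j < e.1 j ∧ e.1 j < v j + n))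
    {u : ZdEdge d} (hu : u ∈ Λ) : IsSlabInteriorEdge n u := by
  obtain ⟨h1, h2, h3⟩ := (mem_cubeInterior_iff hΛ u).1 hu
  by_cases hu2 : u.2 = 0
  · refine Or.inl ⟨hu2, ?_, ?_⟩
    · have := (h1 0).1; rw [hv0] at this; exact this
    · have := h2; rw [hu2, hv0] at this; simpa using this
  · refine Or.inr ⟨hu2, ?_, ?_⟩
    · have := (h3 0 (Ne.symm hu2)).1; rw [hv0] at this; exact this
    · have := (h3 0 (Ne.symm hu2)).2; rw [hv0] at this; simpa using this

/-- **A boundary link of a full-height cube that is an interior slab link lies on a SPATIAL face**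
(Chatterjee 2021, proof of Lemma 9.1: «since `δ` and `δ'` agree on the temporal faces … `A` consists of all
boundary edges of `B` where the boundary conditions defined by `x` and `x'` disagree», i.e. only the spatial
boundary `∂'E` carries influence): if `y` is a link of the cube `v + {0,…,n}^d`, `v₀ = 0`, not an interior link of
it, and an interior link of the slab, then `y_j = v_j` or `y_j = v_j + n` for some spatial direction `j ≠ 0`
(`j ≠` the direction of `y`). [cite: Chatterjee2021, §9 proof of Lemma 9.1] -/
theorem exists_spatial_face_of_boundary [NeZero d] {v : Fin d → ℤ} {n : ℕ} (hv0 : v 0 = 0)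
    {y : ZdEdge d} (hy1 : ∀ j, v j ≤ y.1 j ∧ y.1 j ≤ v j + n)
    (hy3 : ¬ ∀ j, j ≠ y.2 → v j < y.1 j ∧ y.1 j < v j + n) (hyW : IsSlabInteriorEdge n y) :
    ∃ j : Fin d, j ≠ 0 ∧ j ≠ y.2 ∧ (y.1 j = v j ∨ y.1 j = v j + n) := by
  push Not at hy3
  obtain ⟨j, hj, hj'⟩ := hy3
  have hface : y.1 j = v j ∨ y.1 j = v j + n := by
    rcases lt_or_eq_of_le (hy1 j).1 with h | h
    · right; exact le_antisymm (hy1 j).2 (hj' h)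
    · left; exact h.symm
  refine ⟨j, fun hj0 => ?_, hj, hface⟩
  subst hj0
  -- a temporal face: `y₀ ∈ {0, n}` with `y` horizontal contradicts `0 < y₀ < n`
  rcases hyW with ⟨hy0, -, -⟩ | ⟨-, hpos, hlt⟩
  · exact hj hy0.symm
  · rw [hv0] at hface
    rcases hface with h | h
    · rw [h] at hpos; exact lt_irrefl _ hpos
    · rw [h] at hlt; simp at hlt

/-- **Every interior slab link lies in its own cube window**: for `n ≥ 2` and an interior link `c` of the slab
`{0 ≤ x₀ ≤ n}`, `c` is an interior link of the cube `b(c) + {0,…,n}^d`, `b(c) = (0, c₁ − 1, …, c_{d−1} − 1)`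
(Chatterjee 2021 §10, the cubes `𝔅(e) ∋ e`). [cite: Chatterjee2021, §10] -/
theorem self_mem_cubeInterior_base [NeZero d] {n : ℕ} (hn : 2 ≤ n) {c : ZdEdge d}
    (hc : IsSlabInteriorEdge n c) {Λ : Finset (ZdEdge d)}
    (hΛ : Λ = (((Fintype.piFinset fun j : Fin d =>
        Finset.Icc ((fun j : Fin d => if j = 0 then (0 : ℤ) else c.1 j - 1) j)
          ((fun j : Fin d => if j = 0 then (0 : ℤ) else c.1 j - 1) j + n)) ×ˢ
        (Finset.univ : Finset (Fin d))).filter fun e =>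
          e.1 e.2 + 1 ≤ (fun j : Fin d => if j = 0 then (0 : ℤ) else c.1 j - 1) e.2 + n ∧
          ∀ j, j ≠ e.2 → (fun j : Fin d => if j = 0 then (0 : ℤ) else c.1 j - 1) j < e.1 j ∧
            e.1 j < (fun j : Fin d => if j = 0 then (0 : ℤ) else c.1 j - 1) j + n)) :
    c ∈ Λ := by
  rw [mem_cubeInterior_iff hΛ]
  have hn' : (2 : ℤ) ≤ n := by exact_mod_cast hn
  rcases hc with ⟨hc2, h0, h1⟩ | ⟨hc2, h0, h1⟩
  · refine ⟨fun j => ?_, ?_, fun j hj => ?_⟩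
    · by_cases hj0 : j = 0
      · subst hj0; simp only [if_true]; constructor <;> omega
      · simp only [if_neg hj0]; constructor <;> omega
    · rw [hc2]; simp only [if_true]; omega
    · rw [hc2] at hj; simp only [if_neg hj]; constructor <;> omega
  · refine ⟨fun j => ?_, ?_, fun j hj => ?_⟩
    · by_cases hj0 : j = 0
      · subst hj0; simp only [if_true]; constructor <;> omega
      · simp only [if_neg hj0]; constructor <;> omega
    · simp only [if_neg hc2]; omega
    · by_cases hj0 : j = 0
      · subst hj0; simp only [if_true]; constructor <;> omega
      · simp only [if_neg hj0]; constructor <;> omega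

/-! ### §2 Shell counting -/

/-- **At most `d (2k+1)^d` links at base-point sup-distance `k` from a given link**: the links `y` of any finite
set with `⌊‖x − y‖_∞⌋ = k` have base point in the box `x + [−k, k]^d`. [folklore] -/
private theorem card_filter_floor_norm_sub_eq_le (s : Finset (ZdEdge d)) (x : ZdEdge d) (k : ℕ) :
    (s.filter fun y => ⌊‖x.1 - y.1‖⌋₊ = k).card ≤ d * (2 * k + 1) ^ d := by
  classical
  set box : Finset (ZdEdge d) := (Fintype.piFinset fun j : Fin d =>
    Finset.Icc (x.1 j - k) (x.1 j + k)) ×ˢ (Finset.univ : Finset (Fin d)) with hbox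
  have hsub : (s.filter fun y => ⌊‖x.1 - y.1‖⌋₊ = k) ⊆ box := by
    intro y hy
    obtain ⟨-, hyk⟩ := Finset.mem_filter.1 hy
    rw [hbox, Finset.mem_product]
    refine ⟨Fintype.mem_piFinset.2 fun j => Finset.mem_Icc.2 ?_, Finset.mem_univ _⟩
    have hlt : ‖x.1 - y.1‖ < (k : ℝ) + 1 := by
      have := Nat.lt_floor_add_one ‖x.1 - y.1‖
      rw [hyk] at this
      exact_mod_cast this
    have hj : ‖(x.1 - y.1) j‖ ≤ ‖x.1 - y.1‖ := norm_le_pi_norm _ j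
    rw [Pi.sub_apply, Int.norm_eq_abs] at hj
    have habs : |((x.1 j - y.1 j : ℤ) : ℝ)| < (k : ℝ) + 1 := by push_cast at hj ⊢; linarith
    have habs' : |x.1 j - y.1 j| ≤ (k : ℤ) := by
      have h1 : ((|x.1 j - y.1 j| : ℤ) : ℝ) < (k : ℝ) + 1 := by
        rw [Int.cast_abs]; exact habs
      have h2 : (|x.1 j - y.1 j| : ℤ) < (k : ℤ) + 1 := by exact_mod_cast h1
      omega
    rw [abs_le] at habs'
    constructor <;> omega
  refine (Finset.card_le_card hsub).trans (le_of_eq ?_)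
  rw [hbox, Finset.card_product, Fintype.card_piFinset, Finset.card_univ, Fintype.card_fin, mul_comm]
  congr 1
  have hfac : ∀ j : Fin d, (Finset.Icc (x.1 j - k) (x.1 j + k)).card = 2 * k + 1 := fun j => by
    rw [Int.card_Icc]
    have e : x.1 j + k + 1 - (x.1 j - k) = ((2 * k + 1 : ℕ) : ℤ) := by push_cast; ring
    rw [e, Int.toNat_natCast]
  rw [Finset.prod_congr rfl fun j _ => hfac j, Finset.prod_const, Finset.card_univ, Fintype.card_fin]

/-- **Shell summation**: for `κ ≥ 0` and a finite set `s` of links all within base-point sup-distance `n` of `x`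
(`⌊‖x − y‖_∞⌋ ≤ n`), `Σ_{y ∈ s} κ(⌊‖x − y‖_∞⌋) ≤ Σ_{k=0}^{n} d (2k+1)^d κ(k)`. [folklore] -/
private theorem sum_floor_norm_le_sum_range {κ : ℕ → ℝ} (hκ : ∀ k, 0 ≤ κ k) (s : Finset (ZdEdge d))
    (x : ZdEdge d) (n : ℕ) (hs : ∀ y ∈ s, ⌊‖x.1 - y.1‖⌋₊ ≤ n) :
    ∑ y ∈ s, κ ⌊‖x.1 - y.1‖⌋₊ ≤ ∑ k ∈ Finset.range (n + 1), (d * (2 * k + 1) ^ d : ℕ) * κ k := by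
  classical
  rw [← Finset.sum_fiberwise_of_maps_to (g := fun y : ZdEdge d => ⌊‖x.1 - y.1‖⌋₊)
    (t := Finset.range (n + 1)) (fun y hy => Finset.mem_range.2 (Nat.lt_succ_of_le (hs y hy)))]
  refine Finset.sum_le_sum fun k _ => ?_
  have h1 : ∑ y ∈ s.filter (fun y => ⌊‖x.1 - y.1‖⌋₊ = k), κ ⌊‖x.1 - y.1‖⌋₊ =
      ((s.filter fun y => ⌊‖x.1 - y.1‖⌋₊ = k).card : ℝ) * κ k := by
    rw [Finset.sum_congr rfl fun y hy => by rw [(Finset.mem_filter.1 hy).2], Finset.sum_const,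
      nsmul_eq_mul]
  rw [h1]
  refine mul_le_mul_of_nonneg_right ?_ (hκ k)
  exact_mod_cast card_filter_floor_norm_sub_eq_le s x k

/-! ### §3 The candidate centres around a link; pinned-coordinate counting -/

/-- **Pinning one coordinate of a candidate centre**: among the links `c` with `c₀ ∈ [0, n]` and
`c_j ∈ [x_j + 1 − n, x_j + 1]` (`j ≠ 0`) — the candidate centres of the cube windows containing `x` — those with a
prescribed value of one coordinate number at most `d (n+1)^{d−1}`. [folklore] -/
private theorem card_filter_apply_eq_le [NeZero d] (x : ZdEdge d) (n : ℕ) (i : Fin d) (a : ℤ)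
    {cand : Finset (ZdEdge d)}
    (hcand : cand = (Fintype.piFinset fun j : Fin d =>
      if j = 0 then Finset.Icc (0 : ℤ) n else Finset.Icc (x.1 j + 1 - n) (x.1 j + 1)) ×ˢ
        (Finset.univ : Finset (Fin d))) :
    (cand.filter fun c => c.1 i = a).card ≤ d * (n + 1) ^ (d - 1) := by
  classical
  set box' : Fin d → Finset ℤ := fun j => if j = i then {a} else
    (if j = 0 then Finset.Icc (0 : ℤ) n else Finset.Icc (x.1 j + 1 - n) (x.1 j + 1)) with hbox'
  have hsub : (cand.filter fun c => c.1 i = a) ⊆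
      (Fintype.piFinset box') ×ˢ (Finset.univ : Finset (Fin d)) := by
    intro c hc
    obtain ⟨hc1, hc2⟩ := Finset.mem_filter.1 hc
    rw [hcand, Finset.mem_product, Fintype.mem_piFinset] at hc1
    rw [Finset.mem_product, Fintype.mem_piFinset]
    refine ⟨fun j => ?_, Finset.mem_univ _⟩
    by_cases hji : j = i
    · subst hji; simp only [hbox', if_true, Finset.mem_singleton]; exact hc2
    · simp only [hbox', if_neg hji]; exact hc1.1 j
  refine (Finset.card_le_card hsub).trans ?_
  rw [Finset.card_product, Fintype.card_piFinset, Finset.card_univ, Fintype.card_fin, mul_comm]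
  refine Nat.mul_le_mul_left d ?_
  have hcard : ∀ j, (box' j).card ≤ (if j = i then 1 else n + 1) := by
    intro j
    by_cases hji : j = i
    · subst hji; simp [hbox']
    · simp only [hbox', if_neg hji]
      split_ifs
      · rw [Int.card_Icc]; simp
      · rw [Int.card_Icc]
        have e : x.1 j + 1 + 1 - (x.1 j + 1 - n) = ((n + 1 : ℕ) : ℤ) := by push_cast; ring
        rw [e, Int.toNat_natCast]
  calc ∏ j, (box' j).card ≤ ∏ j, (if j = i then 1 else n + 1) := Finset.prod_le_prod' fun j _ => hcard j
    _ = (n + 1) ^ (d - 1) := by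
        rw [← Finset.prod_erase_mul _ _ (Finset.mem_univ i), if_pos rfl, mul_one,
          Finset.prod_congr rfl fun j hj => if_neg (Finset.ne_of_mem_erase hj), Finset.prod_const,
          Finset.card_erase_of_mem (Finset.mem_univ i), Finset.card_univ, Fintype.card_fin]

/-- **A link lies on a spatial face of few candidate cubes** (Chatterjee 2021, proof of Lemma 10.1: «for any edge
`e`, there can be at most `C N^{d−2}` cubes `B ∈ 𝔅` such that `e ∈ ∂'E`»; here the cruder `2d(d−1)(n+1)^{d−1}`
over the candidate centres around a fixed link `x`): the candidate centres `c` whose cube `b(c) + {0,…,n}^d`,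
`b(c) = (0, c₁−1, …)`, has the interior slab link `y` as a non-interior link number at most `2d(d−1)(n+1)^{d−1}` —
such a `y` lies on a spatial face, which pins one spatial coordinate of `c` to one of two values.
[cite: Chatterjee2021, §10 proof of Lemma 10.1] -/
theorem card_cover_boundary_le [NeZero d] (x y : ZdEdge d) (n : ℕ) (hyW : IsSlabInteriorEdge n y)
    {cand : Finset (ZdEdge d)}
    (hcand : cand = (Fintype.piFinset fun j : Fin d =>
      if j = 0 then Finset.Icc (0 : ℤ) n else Finset.Icc (x.1 j + 1 - n) (x.1 j + 1)) ×ˢ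
        (Finset.univ : Finset (Fin d)))
    (P : ZdEdge d → Prop) [DecidablePred P]
    (hP : ∀ c, P c → (∀ j, (fun j : Fin d => if j = 0 then (0 : ℤ) else c.1 j - 1) j ≤ y.1 j ∧
        y.1 j ≤ (fun j : Fin d => if j = 0 then (0 : ℤ) else c.1 j - 1) j + n) ∧
      y.1 y.2 + 1 ≤ (fun j : Fin d => if j = 0 then (0 : ℤ) else c.1 j - 1) y.2 + n ∧
      ¬ ∀ j, j ≠ y.2 → (fun j : Fin d => if j = 0 then (0 : ℤ) else c.1 j - 1) j < y.1 j ∧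
        y.1 j < (fun j : Fin d => if j = 0 then (0 : ℤ) else c.1 j - 1) j + n) :
    (cand.filter P).card ≤ 2 * d * (d - 1) * (n + 1) ^ (d - 1) := by
  classical
  -- every such centre has one spatial coordinate pinned to one of two values
  have hsub : cand.filter P ⊆ (Finset.univ.erase (0 : Fin d)).biUnion fun j =>
      cand.filter (fun c => c.1 j = y.1 j + 1) ∪ cand.filter (fun c => c.1 j = y.1 j + 1 - n) := by
    intro c hc
    obtain ⟨hc1, hc2⟩ := Finset.mem_filter.1 hc
    obtain ⟨h1, -, h3⟩ := hP c hc2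
    obtain ⟨j, hj0, -, hface⟩ := exists_spatial_face_of_boundary (v := fun j : Fin d =>
      if j = 0 then (0 : ℤ) else c.1 j - 1) (by simp) h1 h3 hyW
    simp only [if_neg hj0] at hface
    refine Finset.mem_biUnion.2 ⟨j, Finset.mem_erase.2 ⟨hj0, Finset.mem_univ _⟩, ?_⟩
    rcases hface with h | h
    · exact Finset.mem_union_left _ (Finset.mem_filter.2 ⟨hc1, by omega⟩)
    · exact Finset.mem_union_right _ (Finset.mem_filter.2 ⟨hc1, by omega⟩)
  refine (Finset.card_le_card hsub).trans (Finset.card_biUnion_le.trans ?_)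
  have hterm : ∀ j ∈ Finset.univ.erase (0 : Fin d),
      (cand.filter (fun c => c.1 j = y.1 j + 1) ∪ cand.filter (fun c => c.1 j = y.1 j + 1 - n)).card ≤
        2 * (d * (n + 1) ^ (d - 1)) := fun j _ =>
    (Finset.card_union_le _ _).trans (by
      have h1 := card_filter_apply_eq_le x n j (y.1 j + 1) hcand
      have h2 := card_filter_apply_eq_le x n j (y.1 j + 1 - n) hcand
      omega)
  refine (Finset.sum_le_sum hterm).trans (le_of_eq ?_)
  rw [Finset.sum_const, Finset.card_erase_of_mem (Finset.mem_univ _), Finset.card_univ, Fintype.card_fin,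
    smul_eq_mul]
  ring

/-! ### §4 The averaged received sum of the cube window system -/

/-- ★ **The averaged received sum of Dobrushin–Shlosman's condition `C_V` for the cube windows of the slab**
(Chatterjee 2021, proofs of Lemma 10.1 / 11.1 in the Dobrushin–Shlosman bookkeeping). Windows: to every interior
slab link `c` the interior `win c` of the cube `b(c) + {0,…,n}^d`, `b(c) = (0, c₁−1, …)`, with link set `nbhd c`;
influence array `K c y x = κ(⌊‖x − y‖_∞⌋)` for `x ∈ win c` and `y ∈ nbhd c ∖ win c` (`κ ≥ 0`), `0` otherwise;
`cover x` = the candidate centres `c` (`c₀ ∈ [0,n]`, `c_j ∈ [x_j+1−n, x_j+1]`) that are interior slab links with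
`x ∈ win c`. Then, counting only the boundary links that are interior SLAB links (the frozen temporal faces carry no
influence), `Σ_{c ∈ cover x} Σ_{y ∈ nbhd c, y interior slab link} K c y x ≤ 2d(d−1)(n+1)^{d−1} Σ_{k=0}^{n} d(2k+1)^d κ(k)`:
exchange the sums, use that each `y` (within distance `n` of `x`) lies on a spatial face of at most
`2d(d−1)(n+1)^{d−1}` candidate cubes, and count the `y` in shells. [cite: Chatterjee2021, §§10–11 (proofs of Lemma 10.1, Lemma 11.1)] -/
theorem sum_cover_boundary_influence_le [NeZero d] {κ : ℕ → ℝ} (hκ : ∀ k, 0 ≤ κ k) (n : ℕ) (x : ZdEdge d)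
    (win nbhd cover : ZdEdge d → Finset (ZdEdge d)) (K : ZdEdge d → ZdEdge d → ZdEdge d → ℝ)
    (hwin : ∀ c, IsSlabInteriorEdge n c → win c = (((Fintype.piFinset fun j : Fin d =>
        Finset.Icc ((fun j : Fin d => if j = 0 then (0 : ℤ) else c.1 j - 1) j)
          ((fun j : Fin d => if j = 0 then (0 : ℤ) else c.1 j - 1) j + n)) ×ˢ
        (Finset.univ : Finset (Fin d))).filter fun e =>
          e.1 e.2 + 1 ≤ (fun j : Fin d => if j = 0 then (0 : ℤ) else c.1 j - 1) e.2 + n ∧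
          ∀ j, j ≠ e.2 → (fun j : Fin d => if j = 0 then (0 : ℤ) else c.1 j - 1) j < e.1 j ∧
            e.1 j < (fun j : Fin d => if j = 0 then (0 : ℤ) else c.1 j - 1) j + n))
    (hnbhd : ∀ c, IsSlabInteriorEdge n c → nbhd c = (((Fintype.piFinset fun j : Fin d =>
        Finset.Icc ((fun j : Fin d => if j = 0 then (0 : ℤ) else c.1 j - 1) j)
          ((fun j : Fin d => if j = 0 then (0 : ℤ) else c.1 j - 1) j + n)) ×ˢ
        (Finset.univ : Finset (Fin d))).filter fun e =>
          e.1 e.2 + 1 ≤ (fun j : Fin d => if j = 0 then (0 : ℤ) else c.1 j - 1) e.2 + n))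
    (hK : ∀ c y, IsSlabInteriorEdge n c → x ∈ win c → y ∈ nbhd c →
      K c y x = if y ∉ win c then κ ⌊‖x.1 - y.1‖⌋₊ else 0)
    (hcover : cover x = ((Fintype.piFinset fun j : Fin d =>
      if j = 0 then Finset.Icc (0 : ℤ) n else Finset.Icc (x.1 j + 1 - n) (x.1 j + 1)) ×ˢ
        (Finset.univ : Finset (Fin d))).filter fun c => IsSlabInteriorEdge n c ∧ x ∈ win c) :
    ∑ c ∈ cover x, ∑ y ∈ (nbhd c).filter (fun y => IsSlabInteriorEdge n y), K c y x ≤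
      (2 * d * (d - 1) * (n + 1) ^ (d - 1) : ℕ) *
        ∑ k ∈ Finset.range (n + 1), (d * (2 * k + 1) ^ d : ℕ) * κ k := by
  classical
  -- the candidate centres and the links within sup-distance `n` of `x`
  set cand : Finset (ZdEdge d) := (Fintype.piFinset fun j : Fin d =>
    if j = 0 then Finset.Icc (0 : ℤ) n else Finset.Icc (x.1 j + 1 - n) (x.1 j + 1)) ×ˢ
      (Finset.univ : Finset (Fin d)) with hcand
  set Y : Finset (ZdEdge d) := (Fintype.piFinset fun j : Fin d =>
    Finset.Icc (x.1 j - n) (x.1 j + n)) ×ˢ (Finset.univ : Finset (Fin d)) with hY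
  -- the boundary-and-slab-interior links of the window of `c`
  set Bd : ZdEdge d → Finset (ZdEdge d) := fun c =>
    ((nbhd c).filter fun y => IsSlabInteriorEdge n y).filter fun y => y ∉ win c with hBd
  have hcov_mem : ∀ c, c ∈ cover x → c ∈ cand ∧ IsSlabInteriorEdge n c ∧ x ∈ win c := fun c hc => by
    rw [hcover] at hc
    obtain ⟨h1, h2⟩ := Finset.mem_filter.1 hc
    exact ⟨h1, h2⟩
  -- facts about `x ∈ win c` and `y ∈ Bd c` for `c ∈ cover x`
  have hxwin : ∀ c, c ∈ cover x → (∀ j, (fun j : Fin d => if j = 0 then (0 : ℤ) else c.1 j - 1) j ≤ x.1 j ∧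
      x.1 j ≤ (fun j : Fin d => if j = 0 then (0 : ℤ) else c.1 j - 1) j + n) := fun c hc => by
    obtain ⟨-, hcW, hxc⟩ := hcov_mem c hc
    exact ((mem_cubeInterior_iff (hwin c hcW) x).1 hxc).1
  have hBd_mem : ∀ c, c ∈ cover x → ∀ y, y ∈ Bd c →
      ((∀ j, (fun j : Fin d => if j = 0 then (0 : ℤ) else c.1 j - 1) j ≤ y.1 j ∧
        y.1 j ≤ (fun j : Fin d => if j = 0 then (0 : ℤ) else c.1 j - 1) j + n) ∧
      y.1 y.2 + 1 ≤ (fun j : Fin d => if j = 0 then (0 : ℤ) else c.1 j - 1) y.2 + n ∧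
      ¬ ∀ j, j ≠ y.2 → (fun j : Fin d => if j = 0 then (0 : ℤ) else c.1 j - 1) j < y.1 j ∧
        y.1 j < (fun j : Fin d => if j = 0 then (0 : ℤ) else c.1 j - 1) j + n) ∧
      IsSlabInteriorEdge n y := by
    intro c hc y hy
    obtain ⟨-, hcW, -⟩ := hcov_mem c hc
    obtain ⟨hy1, hy2⟩ := Finset.mem_filter.1 hy
    obtain ⟨hy3, hy4⟩ := Finset.mem_filter.1 hy1
    obtain ⟨h1, h2⟩ := (mem_cubeEdges_iff (hnbhd c hcW) y).1 hy3
    have hiff := mem_cubeInterior_iff (hwin c hcW) y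
    refine ⟨⟨h1, h2, fun h3 => hy2 (hiff.2 ⟨h1, h2, h3⟩)⟩, hy4⟩
  -- `Bd c ⊆ Y` and every `y ∈ Y` has `⌊‖x − y‖⌋ ≤ n`
  have hBdY : ∀ c, c ∈ cover x → Bd c ⊆ Y := by
    intro c hc y hy
    obtain ⟨⟨h1, -, -⟩, -⟩ := hBd_mem c hc y hy
    have hx1 := hxwin c hc
    rw [hY, Finset.mem_product]
    refine ⟨Fintype.mem_piFinset.2 fun j => Finset.mem_Icc.2 ?_, Finset.mem_univ _⟩
    have := h1 j; have := hx1 j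
    constructor <;> omega
  have hYn : ∀ y ∈ Y, ⌊‖x.1 - y.1‖⌋₊ ≤ n := by
    intro y hy
    rw [hY, Finset.mem_product, Fintype.mem_piFinset] at hy
    have hnorm : ‖x.1 - y.1‖ ≤ (n : ℝ) := by
      refine (pi_norm_le_iff_of_nonneg (Nat.cast_nonneg n)).2 fun j => ?_
      rw [Pi.sub_apply, Int.norm_eq_abs]
      have hj := Finset.mem_Icc.1 (hy.1 j)
      push_cast
      rw [abs_le]
      have e1 : ((x.1 j : ℤ) : ℝ) - n ≤ y.1 j := by exact_mod_cast hj.1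
      have e2 : ((y.1 j : ℤ) : ℝ) ≤ x.1 j + n := by exact_mod_cast hj.2
      constructor <;> linarith
    exact (Nat.floor_le_floor hnorm).trans (Nat.floor_natCast n).le
  -- rewrite the inner sums over `Bd c`
  have hinner : ∀ c, c ∈ cover x → ∑ y ∈ (nbhd c).filter (fun y => IsSlabInteriorEdge n y), K c y x =
      ∑ y ∈ Bd c, κ ⌊‖x.1 - y.1‖⌋₊ := by
    intro c hc
    obtain ⟨-, hcW, hxc⟩ := hcov_mem c hc
    show _ = ∑ y ∈ ((nbhd c).filter fun y => IsSlabInteriorEdge n y).filter (fun y => y ∉ win c),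
      κ ⌊‖x.1 - y.1‖⌋₊
    rw [Finset.sum_filter (fun y => y ∉ win c)]
    refine Finset.sum_congr rfl fun y hy => ?_
    exact hK c y hcW hxc (Finset.mem_filter.1 hy).1
  rw [Finset.sum_congr rfl hinner]
  -- exchange the sums: `Σ_c Σ_{y ∈ Bd c} g y = Σ_{y ∈ Y} g y · #{c : y ∈ Bd c}`
  have hexch : ∑ c ∈ cover x, ∑ y ∈ Bd c, κ ⌊‖x.1 - y.1‖⌋₊ =
      ∑ y ∈ Y, κ ⌊‖x.1 - y.1‖⌋₊ * ((cover x).filter fun c => y ∈ Bd c).card := by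
    have h1 : ∀ c ∈ cover x, ∑ y ∈ Bd c, κ ⌊‖x.1 - y.1‖⌋₊ =
        ∑ y ∈ Y, if y ∈ Bd c then κ ⌊‖x.1 - y.1‖⌋₊ else 0 := by
      intro c hc
      rw [← Finset.sum_filter, Finset.filter_mem_eq_inter, Finset.inter_eq_right.2 (hBdY c hc)]
    rw [Finset.sum_congr rfl h1, Finset.sum_comm]
    refine Finset.sum_congr rfl fun y _ => ?_
    rw [← Finset.sum_filter, Finset.sum_const, nsmul_eq_mul, mul_comm]
  rw [hexch]
  -- bound the multiplicities and count the shells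
  calc ∑ y ∈ Y, κ ⌊‖x.1 - y.1‖⌋₊ * ((cover x).filter fun c => y ∈ Bd c).card
      ≤ ∑ y ∈ Y, κ ⌊‖x.1 - y.1‖⌋₊ * (2 * d * (d - 1) * (n + 1) ^ (d - 1) : ℕ) := by
        refine Finset.sum_le_sum fun y _ => mul_le_mul_of_nonneg_left ?_ (hκ _)
        by_cases hne : ((cover x).filter fun c => y ∈ Bd c) = ∅
        · rw [hne, Finset.card_empty]; exact_mod_cast Nat.zero_le _
        · obtain ⟨c₀, hc₀⟩ := Finset.nonempty_iff_ne_empty.2 hne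
          have hyW : IsSlabInteriorEdge n y :=
            (hBd_mem c₀ (Finset.mem_filter.1 hc₀).1 y (Finset.mem_filter.1 hc₀).2).2
          have hsub : ((cover x).filter fun c => y ∈ Bd c) ⊆
              cand.filter fun c => c ∈ cover x ∧ y ∈ Bd c := by
            intro c hc
            obtain ⟨hc1, hc2⟩ := Finset.mem_filter.1 hc
            exact Finset.mem_filter.2 ⟨(hcov_mem c hc1).1, hc1, hc2⟩
          have hnat : ((cover x).filter fun c => y ∈ Bd c).card ≤ 2 * d * (d - 1) * (n + 1) ^ (d - 1) :=
            (Finset.card_le_card hsub).trans (card_cover_boundary_le x y n hyW hcand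
              (fun c => c ∈ cover x ∧ y ∈ Bd c) fun c hc => (hBd_mem c hc.1 y hc.2).1)
          exact_mod_cast hnat
    _ = (2 * d * (d - 1) * (n + 1) ^ (d - 1) : ℕ) * ∑ y ∈ Y, κ ⌊‖x.1 - y.1‖⌋₊ := by
        rw [Finset.mul_sum]; exact Finset.sum_congr rfl fun y _ => mul_comm _ _
    _ ≤ (2 * d * (d - 1) * (n + 1) ^ (d - 1) : ℕ) *
          ∑ k ∈ Finset.range (n + 1), (d * (2 * k + 1) ^ d : ℕ) * κ k :=
        mul_le_mul_of_nonneg_left (sum_floor_norm_le_sum_range hκ Y x n hYn) (Nat.cast_nonneg _)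

end SlabCubes

end Literature.MathematicalPhysics.QuantumLattice

end
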